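import Summits.AtomisticToContinuum.Crystallization.Theorems.ChartedZeroExcessLayeredLatticeLiouvilleZZZTA

/-!
# lens-2 g87 NODE «RigidQuotient» ZZZT — part 2 of 2 (sequel of `…ChartedZeroExcessLayeredLatticeLiouvilleZZZTA`)

Split for the 400-line cap by the landing lane (hand-2 g41); the module docstring of part 1 (`…ChartedZeroExcessLayeredLatticeLiouvilleZZZTA`) describes the whole node.  Same namespace; all FQNs unchanged.
0 sorry; standard axioms.
-/

noncomputable section
open scoped BigOperators Classical InnerProductSpace RealInnerProductSpace
open MeasureTheory Set Metric Filter Topology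
open Literature.Geometry.DiscreteGeometry (IsTwoShellGoodSet)
open Literature.MathematicalPhysics.StatisticalMechanics (lennardJones card_le_of_separated_of_dist_le)

namespace Summit.AtomisticToContinuum.Crystallization.Theorems.ChartedZeroExcessLayeredLatticeLiouville

open Summit.AtomisticToContinuum.Crystallization.Theorems.ChartedPlanarOrderRigidityDoor (E3 IsClean)
open Summit.AtomisticToContinuum.Crystallization.Theorems.ChartedPlanarOrderDensityDichotomy (μS IsSep)
open Summit.AtomisticToContinuum.Crystallization.Theorems.ChartedPlanarOrderCleanScaleP (IsCleanP IsDoorSetP)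
open Summit.AtomisticToContinuum.Crystallization.Theorems.ChartedPlanarOrderMesoCut (LayeredHom EnvClose)
open Summit.AtomisticToContinuum.Crystallization.Theorems.ChartedPlanarOrderDoorLayeredOsc (IsTwoShellAffineGood)

/-! ### ZZZT-3  Glue, weaker-than certificates, the honest well, the W2‴ doors -/

section Glue

/-- ★★★ **THE RIGIDITY GLUE (PROVED): (RGᴸ)(Rd, cR ≥ 0) ∧ (TGᴸ)(m₀) ⟹ (RDᴸ)(Rd, D₀ := cR·m₀).**  Take the proper rigid motion that (RGᴸ) provides for the
given filling and rotation field; off the outer tube (TGᴸ) floors its misfit. [this file, g87] -/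
theorem offTubeDeficitFloorP_of_rigidity {ϑc ϑp r rΘ q rsh ρ rm σ ϑr Rs ε rI ℓ Rg sb dI dB sb₁ dI₁ dB₁ Rd cR m₀ aHi Λ θ s : ℝ} (hcR : 0 ≤ cR)
    (hRG : DeficitRigidityP ϑc ϑp r rΘ q rsh ρ rm σ ϑr Rs ε rI ℓ Rg sb₁ dI₁ dB₁ Rd cR aHi Λ θ s)
    (hTG : OffTubeRigidGapP ϑc ϑp r rΘ q rsh ρ rm σ ϑr Rs ε rI ℓ Rg sb dI dB sb₁ dI₁ dB₁ m₀ aHi Λ θ s) :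
    OffTubeDeficitFloorP ϑc ϑp r rΘ q rsh ρ rm σ ϑr Rs ε rI ℓ Rg sb dI dB sb₁ dI₁ dB₁ Rd (cR * m₀) aHi Λ θ s := by
  intro δ hδ a ha S hS hsum hgood L w hLw x₀ K hKS hKq hmild hcool n xf hxf hrange L' w' U t hC lab hlab hoff y hyT V hV
  obtain ⟨R, c, hR, hle⟩ := hRG δ hδ a ha S hS hsum hgood L w hLw x₀ K hKS hKq hmild hcool n xf hxf hrange L' w' U t hC lab hlab y hyT V hV
  have hm := hTG δ hδ a ha S hS hsum hgood L w hLw x₀ K hKS hKq hmild hcool n xf hxf hrange L' w' U t hC lab hlab hoff y hyT R c hR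
  nlinarith [mul_le_mul_of_nonneg_left hm hcR]

/-- ★★ **WEAKER-THAN CERTIFICATE (PROVED): (RDᴸ)(Rd, D₀) ⟹ (TGᴸ)(m₀ := D₀/(4·N))** at `aHi = 1`, `0 ≤ ρ + q`, with the packing count
`N = (2(ρ + q)/(27/32) + 1)³ ≥ n`: off the tube, plug the CONSTANT field `R` into the floor and use `coreDeficit_const_le`. [this file, g87] -/
theorem offTubeRigidGapP_of_deficitFloor {ϑc ϑp r rΘ q rsh ρ rm σ ϑr Rs ε rI ℓ Rg sb dI dB sb₁ dI₁ dB₁ Rd D₀ Λ θ s : ℝ} (hρq : 0 ≤ ρ + q)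
    (h : OffTubeDeficitFloorP ϑc ϑp r rΘ q rsh ρ rm σ ϑr Rs ε rI ℓ Rg sb dI dB sb₁ dI₁ dB₁ Rd D₀ 1 Λ θ s) :
    OffTubeRigidGapP ϑc ϑp r rΘ q rsh ρ rm σ ϑr Rs ε rI ℓ Rg sb dI dB sb₁ dI₁ dB₁ (D₀ / (4 * (2 * (ρ + q) / (27 / 32) + 1) ^ 3)) 1 Λ θ s := by
  intro δ hδ a ha S hS hsum hgood L w hLw x₀ K hKS hKq hmild hcool n xf hxf hrange L' w' U t hC lab hlab hoff y hyT R c hR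
  have key := h δ hδ a ha S hS hsum hgood L w hLw x₀ K hKS hKq hmild hcool n xf hxf hrange L' w' U t hC lab hlab hoff y hyT (fun _ => R) fun _ => hR
  set N : ℝ := (2 * (ρ + q) / (27 / 32) + 1) ^ 3 with hN
  have hNpos : 0 < N := by
    have h1 : 0 < 2 * (ρ + q) / (27 / 32) + 1 := by positivity
    positivity
  have hn : (n : ℝ) ≤ N := card_core_le (by norm_num : (0 : ℝ) < 27 / 32) (isSep_of_isDoorSetP le_rfl hS) hKq hρq hxf hrange
  have hD := coreDeficit_const_le (Rd := Rd) (y₀ := fun i => lab (xf i)) (y := y) (xf := xf) (R := R) (c := c)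
  have hm0 : 0 ≤ rigidMisfit y xf R c := rigidMisfit_nonneg
  have h1 : D₀ ≤ 4 * N * rigidMisfit y xf R c :=
    key.trans (hD.trans (mul_le_mul_of_nonneg_right (mul_le_mul_of_nonneg_left hn (by norm_num)) hm0))
  calc D₀ / (4 * N) ≤ 4 * N * rigidMisfit y xf R c / (4 * N) := div_le_div_of_nonneg_right h1 (by positivity)
    _ = rigidMisfit y xf R c := by field_simp

/-- ★★★ **THE HONEST WELL (PROVED): (XRᴸ)(ϑ₀, ϑ₁; outer radii) ∧ (X1ᴸ)(lam ≥ 0; outer radii) ∧ inner ⊆ outer ∧ (DWᴹ) ⟹ (DWᴸ).**  Given a critical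
tame filling `y` in the inner tube: the label image is a free tube reference (XRᴸ), so first-order convexity (X1ᴸ) applies at `y ∈` outer tube; its
derivative there is `0` (uniqueness of the Fréchet derivative), whence `E(y) ≤ E(z) − lam·Σ dist² ≤ E(z)` for every outer-, in particular inner-tube
`z`: `y` is the minimiser and (DWᴹ) fires. [this file, g87] -/
theorem deficitWellP_of_min {ϑc ϑ ϑ₀ ϑ₁ ϑp r rΘ q rsh ρ rm σ ϑr Rs ε rI ℓ Rg sb dI dB sb₁ dI₁ dB₁ lam Rd cE σ₀ aHi Λ θ s : ℝ} (hlam : 0 ≤ lam)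
    (hsb : sb₁ ≤ sb) (hdI : dI₁ ≤ dI) (hdB : dB₁ ≤ dB)
    (hR : LabelTubeReferenceP ϑc ϑ₁ ϑp r rΘ q rsh ρ rm σ ϑr Rs ε rI ℓ ϑ₀ Rg sb dI dB aHi Λ θ s)
    (hX1 : LabelTubeConvexityP ϑc ϑ₁ ϑp r rΘ q rsh ρ rm σ ϑr Rs ε rI ℓ ϑ₀ Rg sb dI dB lam aHi Λ θ s)
    (h : DeficitWellMinP ϑc ϑ ϑp r rΘ q rsh ρ rm σ ϑr Rs ε rI ℓ Rg sb₁ dI₁ dB₁ Rd cE σ₀ aHi Λ θ s) :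
    DeficitWellP ϑc ϑ ϑp r rΘ q rsh ρ rm σ ϑr Rs ε rI ℓ Rg sb₁ dI₁ dB₁ Rd cE σ₀ aHi Λ θ s := by
  intro δ hδ a ha S hS hsum hgood L w hLw x₀ K hKS hKq hmild hcool n xf hxf hrange L' w' U t hC lab hlab y hyT hyinj hydisj hcrit htame
  have hfree := hR δ hδ a ha S hS hsum hgood L w hLw x₀ K hKS hKq hmild hcool n xf hxf hrange L' w' U t hC lab hlab
  have hyO : y ∈ bondTube (S \ coreOf S K ρ) Rg sb dI dB (fun i => lab (xf i)) := bondTube_mono hsb hdI hdB hyT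
  obtain ⟨φ, hφ, hconv⟩ := hX1 δ hδ a ha S hS hsum hgood L w hLw x₀ K hKS hKq hmild hcool n xf hxf hrange L' w' U t hC lab hlab hfree y hyO
  have hφ0 : φ = 0 := hφ.unique hcrit
  have hmin : ∀ z ∈ bondTube (S \ coreOf S K ρ) Rg sb₁ dI₁ dB₁ (fun i => lab (xf i)),
      clampedEnergy (S \ coreOf S K ρ) y ≤ clampedEnergy (S \ coreOf S K ρ) z := fun z hz => by
    have hz' := hconv z (bondTube_mono hsb hdI hdB hz)
    rw [hφ0, zero_apply] at hz'
    have hs : 0 ≤ lam * ∑ i, dist (y i) (z i) ^ 2 := mul_nonneg hlam (Finset.sum_nonneg fun i _ => by positivity)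
    linarith
  exact h δ hδ a ha S hS hsum hgood L w hLw x₀ K hKS hKq hmild hcool n xf hxf hrange L' w' U t hC lab hlab y hyT hyinj hydisj hcrit htame hmin

/-- ★★ (RGᴸ) ∧ (TGᴸ) ∧ (DWᴸ) ⟹ (OGᴸ)(cE·(cR·m₀) − σ₀): the gap through the rigidity glue and NODE 86's deficit glue. [this file, g87] -/
theorem offTubeGapP_of_rigidity {ϑc ϑ ϑp r rΘ q rsh ρ rm σ ϑr Rs ε rI ℓ Rg sb dI dB sb₁ dI₁ dB₁ Rd cR m₀ cE σ₀ aHi Λ θ s : ℝ} (hcR : 0 ≤ cR)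
    (hcE : 0 ≤ cE) (hRG : DeficitRigidityP ϑc ϑp r rΘ q rsh ρ rm σ ϑr Rs ε rI ℓ Rg sb₁ dI₁ dB₁ Rd cR aHi Λ θ s)
    (hTG : OffTubeRigidGapP ϑc ϑp r rΘ q rsh ρ rm σ ϑr Rs ε rI ℓ Rg sb dI dB sb₁ dI₁ dB₁ m₀ aHi Λ θ s)
    (hDW : DeficitWellP ϑc ϑ ϑp r rΘ q rsh ρ rm σ ϑr Rs ε rI ℓ Rg sb₁ dI₁ dB₁ Rd cE σ₀ aHi Λ θ s) :
    OffTubeGapP ϑc ϑ ϑp r rΘ q rsh ρ rm σ ϑr Rs ε rI ℓ Rg sb dI dB sb₁ dI₁ dB₁ (cE * (cR * m₀) - σ₀) aHi Λ θ s :=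
  offTubeGapP_of_deficit hcE (offTubeDeficitFloorP_of_rigidity hcR hRG hTG) hDW

/-- ★★★ **THE W2‴ DOOR (PROVED modulo its six hypotheses): `[MCMC](ϑc)` ⟸ (SC) ∧ (X1ᴸ)(lam > 0) ∧ (X2ᴸ)(radii) ∧ (RGᴸ)(Rd, cR) ∧ (TGᴸ)(m₀) ∧
(DWᴹ)(Rd, cE, σ₀)** (`0 ≤ cR`, `0 ≤ cE`, `σ₀ < cE·(cR·m₀)`) at the record dials `(ϑp, r, rΘ, q, rsh, ρ, rm) = (1/10, 8, 145/16, 4, 12, 16, 16)`, shadow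
`(σ, ϑr, Rs, ε, rI, ℓ) = (17/20, 10⁻⁴, 5, 10⁻⁴, 10, 43/2)`, `(aHi, Λ, θ, s) = (1, 2, 1/16, 1/50)`, door level `tameRadius`, outer radii in ZZZQ's (XRᴸ)
polytope — NODE 86's W2″ door with (RDᴸ) REPLACED by the rigidity pair and (DWᴸ) by the honest well (through `labelTubeReferenceP_record` and the same
(X1ᴸ) the door already carries). [this file, g87] -/
theorem mildCoolMoatCorePG_W2'''_record {ϑc ϑ₀ Rg sb dI dB sb₁ dI₁ dB₁ lam Rd cR m₀ cE σ₀ : ℝ}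
    (hlam : 0 < lam) (hcR : 0 ≤ cR) (hcE : 0 ≤ cE) (hgap : σ₀ < cE * (cR * m₀)) (hsb : sb₁ < sb) (hdI : dI₁ < dI) (hdB : dB₁ < dB)
    (hsb₀ : 0 ≤ sb₁) (hdI₀ : 0 ≤ dI₁) (hdB₀ : 0 ≤ dB₁) (h2dB : 2 * dB < 17 / 20) (hRg : 4 + 2 * dB ≤ Rg) (hRs : 4 + 2 * dB + 1 / 10000 ≤ 5)
    (hfit : 16 + 1 / 10000 + Rg < 43 / 2) (hdIσ : dI + 1 / 10000 < 17 / 20) (hϑ₀ : (1 : ℝ) / 10000 + 1 / 10000 ≤ ϑ₀)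
    (hϑ : ϑ₀ + max sb dI ≤ tameRadius)
    (hSC : CoolZoneShadowCrystalP ϑc (1 / 10) 8 4 12 16 (17 / 20) (1 / 10000) 5 (1 / 10000) 10 (43 / 2) 1 2 (1 / 16) (1 / 50))
    (hX1 : LabelTubeConvexityP ϑc tameRadius (1 / 10) 8 (145 / 16) 4 12 16 16 (17 / 20) (1 / 10000) 5 (1 / 10000) 10 (43 / 2) ϑ₀ Rg sb dI dB
      lam 1 2 (1 / 16) (1 / 50))
    (hX2 : LabelLoadedTubeAprioriP ϑc tameRadius (1 / 10) 8 (145 / 16) 4 12 16 16 (17 / 20) (1 / 10000) 5 (1 / 10000) 10 (43 / 2) ϑ₀ Rg sb dI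
      dB sb₁ dI₁ dB₁ 1 2 (1 / 16) (1 / 50))
    (hRG : DeficitRigidityP ϑc (1 / 10) 8 (145 / 16) 4 12 16 16 (17 / 20) (1 / 10000) 5 (1 / 10000) 10 (43 / 2) Rg sb₁ dI₁ dB₁ Rd cR
      1 2 (1 / 16) (1 / 50))
    (hTG : OffTubeRigidGapP ϑc (1 / 10) 8 (145 / 16) 4 12 16 16 (17 / 20) (1 / 10000) 5 (1 / 10000) 10 (43 / 2) Rg sb dI dB sb₁ dI₁ dB₁ m₀
      1 2 (1 / 16) (1 / 50))
    (hDW : DeficitWellMinP ϑc tameRadius (1 / 10) 8 (145 / 16) 4 12 16 16 (17 / 20) (1 / 10000) 5 (1 / 10000) 10 (43 / 2) Rg sb₁ dI₁ dB₁ Rd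
      cE σ₀ 1 2 (1 / 16) (1 / 50)) :
    MildCoolMoatCorePG ϑc tameRadius (1 / 10) 8 4 12 16 1 2 (1 / 16) (1 / 50) :=
  have hR := labelTubeReferenceP_record ϑc (hdB₀.trans hdB.le) h2dB hRg hRs hfit hdIσ hϑ₀ hϑ
  mildCoolMoatCorePG_W2''_record hlam hcE hgap hsb hdI hdB hsb₀ hdI₀ hdB₀ h2dB hRg hRs hfit hdIσ hϑ₀ hϑ hSC hX1 hX2
    (offTubeDeficitFloorP_of_rigidity hcR hRG hTG) (deficitWellP_of_min hlam.le hsb.le hdI.le hdB.le hR hX1 hDW)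

/-- ★★ **THE W2‴ DOOR AT THE FATTEST CERTIFIED TUBE** `(Rg, sb, dI, dB) = (121/25, 249/5000, 249/5000, 21/50)`, `ϑ₀ = 1/5000`, `Rd := Rg = 121/25`, THIN
inner tube `0 ≤ sb₁, dI₁ ≤ sb/4 = 249/20000`, `0 ≤ dB₁ ≤ 2/5` (desk: `m₀ ≈ 5.5·10⁻⁴`, `cR ≈ 21.5`, `D₀ = cR·m₀ ≈ 1.2·10⁻²`, `cE ≈ 5·10⁻⁴`, `σ₀ = 0`):
`[MCMC](ϑc)` ⟸ (SC) ∧ (X1ᴸ)(lam > 0) ∧ (X2ᴸ) ∧ (RGᴸ)(cR) ∧ (TGᴸ)(m₀) ∧ (DWᴹ)(cE, σ₀).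
[this file, g87] -/
theorem mildCoolMoatCorePG_W2'''_fat {ϑc sb₁ dI₁ dB₁ lam cR m₀ cE σ₀ : ℝ} (hlam : 0 < lam) (hcR : 0 ≤ cR) (hcE : 0 ≤ cE)
    (hgap : σ₀ < cE * (cR * m₀)) (hsb : 4 * sb₁ ≤ 249 / 5000) (hdI : 4 * dI₁ ≤ 249 / 5000) (hdB : dB₁ ≤ 2 / 5) (hsb₀ : 0 ≤ sb₁) (hdI₀ : 0 ≤ dI₁)
    (hdB₀ : 0 ≤ dB₁)
    (hSC : CoolZoneShadowCrystalP ϑc (1 / 10) 8 4 12 16 (17 / 20) (1 / 10000) 5 (1 / 10000) 10 (43 / 2) 1 2 (1 / 16) (1 / 50))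
    (hX1 : LabelTubeConvexityP ϑc tameRadius (1 / 10) 8 (145 / 16) 4 12 16 16 (17 / 20) (1 / 10000) 5 (1 / 10000) 10 (43 / 2) (1 / 5000) (121 / 25)
      (249 / 5000) (249 / 5000) (21 / 50) lam 1 2 (1 / 16) (1 / 50))
    (hX2 : LabelLoadedTubeAprioriP ϑc tameRadius (1 / 10) 8 (145 / 16) 4 12 16 16 (17 / 20) (1 / 10000) 5 (1 / 10000) 10 (43 / 2) (1 / 5000)
      (121 / 25) (249 / 5000) (249 / 5000) (21 / 50) sb₁ dI₁ dB₁ 1 2 (1 / 16) (1 / 50))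
    (hRG : DeficitRigidityP ϑc (1 / 10) 8 (145 / 16) 4 12 16 16 (17 / 20) (1 / 10000) 5 (1 / 10000) 10 (43 / 2) (121 / 25) sb₁ dI₁ dB₁ (121 / 25)
      cR 1 2 (1 / 16) (1 / 50))
    (hTG : OffTubeRigidGapP ϑc (1 / 10) 8 (145 / 16) 4 12 16 16 (17 / 20) (1 / 10000) 5 (1 / 10000) 10 (43 / 2) (121 / 25) (249 / 5000) (249 / 5000)
      (21 / 50) sb₁ dI₁ dB₁ m₀ 1 2 (1 / 16) (1 / 50))
    (hDW : DeficitWellMinP ϑc tameRadius (1 / 10) 8 (145 / 16) 4 12 16 16 (17 / 20) (1 / 10000) 5 (1 / 10000) 10 (43 / 2) (121 / 25) sb₁ dI₁ dB₁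
      (121 / 25) cE σ₀ 1 2 (1 / 16) (1 / 50)) :
    MildCoolMoatCorePG ϑc tameRadius (1 / 10) 8 4 12 16 1 2 (1 / 16) (1 / 50) :=
  mildCoolMoatCorePG_W2'''_record hlam hcR hcE hgap (by linarith) (by linarith) (by linarith) hsb₀ hdI₀ hdB₀ (by norm_num) (by norm_num) (by norm_num)
    (by norm_num) (by norm_num) (by norm_num) (by rw [max_self]; norm_num [tameRadius]) hSC hX1 hX2 hRG hTG hDW

end Glue

end Summit.AtomisticToContinuum.Crystallization.Theorems.ChartedZeroExcessLayeredLatticeLiouville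

end
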